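import Summits.QuantumFields.YangMills.Theorems.BalabanUVNodesN15CurvedGluingCubeAdjointCovariantEntrySandwich
import HarnessLib

/-!
# ENTRY 2 AT THE GLUED LEVEL: `𝒢∘(M_R∇^± + M_B) = (𝒢∘∇^±)∘M_{R∘e^∓} − 𝒢∘M_{∇R} + 𝒢∘M_B` (FILE 150's product rule), its plain-currency row from the rows of `𝒢∘∇^±` (FILE 158 ★★) and of `𝒢`, and its
# two-spacing η-defect from theirs (FILE 158 ★★★, FILE 44) and the coefficients' row fits — the last plumbing between FILE 158's output and the node's slot 2 `𝒢∘∇^{U*}`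
# (dag-n15-c g18, FILE 159; N15 = NE2, s1 «background-layer OPERATOR ingredient»)

Cell `pub-ymgap`, seat `pub-ymgap-dag-n15-c` (R134 (a); HUMAN RULING D-0062), generation 18.  `bears_on: R4∕N15 · K3⁸ SpineGivenEndpointR13SepCoPHV (stmt-QuantumFields-27366)`.
Filed `--kind proof --supports stmt-QuantumFields-27366 --as helper` — COUNT-NEUTRAL.  Theorems only; 0 `def`, 0 `sorry`.  Imports BY NAME FILE 157 `…CubeAdjointCovariantEntrySandwich` (through it FILE 150
`mmulOp_comp_fgrad_eq`, `mmulOp_comp_bgrad_eq`, n15-c `hasMaj_mmulOp`, `hasMaj_idef_mmulOp`, n15-w3 `hasMaj_comp_diag`, lit `idef_comp`, `idef_add`, `idef_sub`).  Nothing in the tree is modified.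

WHY (FINDING (ix) of this generation, the entry-2 recipe).  The gluing theorems (FILE 149∕158) are applied with the PURE gradient `E := ∇^±_μ` (scalar adjoint Leibniz), and the transport `R_μ` of
`∇^{U*}_μ = M_{R_μ}∇⁻_μ + M_{B_μ}` is composed AFTERWARDS on the right: THIS FILE is that afterwards — the algebra, the one-grid row in plain currency (the glued operator is global), and the
two-grid defect, for a generic pair `(𝒢, 𝒢_D := 𝒢∘∇^±)` read through letters.

WHAT.  §1 ★ `comp_covShape_fgrad_eq`, ★ `comp_covShape_bgrad_eq`, `mmulOp_comp_fgradAdj_eq`, ★ `comp_covShape_fgradAdj_eq` (the U ≡ 1 knit's letter `E := fgradAdj`); §2 `hasMaj_comp_mmulOp_plain`, ★ `hasMaj_gluedCovShape` (`≤ (c_Dr_R + c·r_{∇R} + c·r_B)e^{−δd}`); §3 `hasMaj_idef_comp_mmulOp_plain`,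
★★ `hasMaj_idef_gluedCovShape` (`𝔇 ≤ [(c_Do_R + m_Dr_R) + (c·o_{∇R} + m·r_{∇R}) + (c·o_B + m·r_B)]e^{−δd}`).

HONEST FRAMING ∕ LIMITS.  Lattice Leibniz + block-majorant bookkeeping over DISPLAYED letters; proves NO estimate of any concrete propagator; nothing of [B5]∕[B6]∕[B9] asserted ((3.42) p.397 entry 2,
(3.64)–(3.65) pp.402–403 = SHAPES; Thm 3.14 pp.426–427 = difference TEMPLATE).  NE2⁺ NOT PRINTED, NOT proved; N15 NOT discharged; K3⁸ OPEN, skeleton v7 untouched (0∕2); counts of record UNMOVED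
by this seat (typed 28∕28 · discharged 7∕28 = 7∕27 excl. NODE O, №245); one finite 𝕋⁴ at fixed ε — NOT infinite volume, NOT OS on ℝ⁴, NOT a mass gap, NOT Clay; R4 closes the conditional finite-𝕋⁴
rung `BalabanLadder.UV` only.  Restate-immune (no Theses import).
-/

set_option autoImplicit false

noncomputable section
open scoped BigOperators

namespace Summit.QuantumFields.YangMills.BalabanUVNodes.N15.Gluing

open Literature.MathematicalPhysics.QuantumFieldTheory.Balaban1983to89
open Literature.MathematicalPhysics.QuantumFieldTheory.Balaban1983to89.B11SectG (BlockNorm HasMaj)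
open Literature.MathematicalPhysics.QuantumFieldTheory.Balaban1983to89.T4EtaRateDefect (idef idef_comp idef_add idef_sub)
open Literature.MathematicalPhysics.QuantumFieldTheory.Balaban1983to89.T4EtaRateCoeffDefect (pull diagK diagK_nonneg)
open Summit.QuantumFields.YangMills.BalabanUVNodes.N15.MatrixSpecies (mmulOp liftBlk liftMap liftEquiv hasMaj_mmulOp hasMaj_idef_mmulOp)
open Summit.QuantumFields.YangMills.BalabanUVNodes.N15.BackgroundLayer (fgrad bgrad fgradAdj fgradMat bgrad_eq_neg_fgradAdj)

/-! ## §1 The transport moves to the right of the glued gradient entry -/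

section Algebra

variable {X ι : Type} [Fintype ι] [DecidableEq ι]

omit [DecidableEq ι] in
/-- ★ `𝒢∘(M_R∇⁺_e + M_B) = (𝒢∘∇⁺_e)∘M_{R∘e⁻¹} − 𝒢∘M_{(∇R)∘e⁻¹} + 𝒢∘M_B` (FILE 150 `mmulOp_comp_fgrad_eq`). [cite: Balaban1985BackgroundPropagators, (3.42) p.397 (entry 2: shape), (3.64)–(3.65) pp.402–403] -/
theorem comp_covShape_fgrad_eq (n : ℝ) (e : X ≃ X) (R B : X → Matrix ι ι ℝ) (G : (X × ι → ℝ) →ₗ[ℝ] (X × ι → ℝ)) :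
    G ∘ₗ (mmulOp R ∘ₗ fgrad n (liftEquiv e ι) + mmulOp B) = (G ∘ₗ fgrad n (liftEquiv e ι)) ∘ₗ mmulOp (R ∘ e.symm) - G ∘ₗ mmulOp (fgradMat n e R ∘ e.symm) + G ∘ₗ mmulOp B := by
  rw [LinearMap.comp_add, mmulOp_comp_fgrad_eq, LinearMap.comp_sub, LinearMap.comp_assoc]

omit [DecidableEq ι] in
/-- ★ `𝒢∘(M_R∇⁻_e + M_B) = (𝒢∘∇⁻_e)∘M_{R∘e} − 𝒢∘M_{∇R} + 𝒢∘M_B` (FILE 150 `mmulOp_comp_bgrad_eq`) — the print's `𝒢∘∇^{U*}_μ` per direction. [cite: Balaban1985BackgroundPropagators, (3.42) p.397 (entry 2: shape), (3.64)–(3.65) pp.402–403] -/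
theorem comp_covShape_bgrad_eq (n : ℝ) (e : X ≃ X) (R B : X → Matrix ι ι ℝ) (G : (X × ι → ℝ) →ₗ[ℝ] (X × ι → ℝ)) :
    G ∘ₗ (mmulOp R ∘ₗ bgrad n (liftEquiv e ι) + mmulOp B) = (G ∘ₗ bgrad n (liftEquiv e ι)) ∘ₗ mmulOp (R ∘ e) - G ∘ₗ mmulOp (fgradMat n e R) + G ∘ₗ mmulOp B := by
  rw [LinearMap.comp_add, mmulOp_comp_bgrad_eq, LinearMap.comp_sub, LinearMap.comp_assoc]

omit [DecidableEq ι] in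
/-- the matrix product rule for the ADJOINT forward difference: `M_R∘∇⁺* = ∇⁺*∘M_{R∘e} + M_{∇R}` (FILE 150 `mmulOp_comp_bgrad_eq` with `∇⁻ = −∇⁺*`). [folklore] -/
theorem mmulOp_comp_fgradAdj_eq (n : ℝ) (e : X ≃ X) (R : X → Matrix ι ι ℝ) :
    mmulOp R ∘ₗ fgradAdj n (liftEquiv e ι) = fgradAdj n (liftEquiv e ι) ∘ₗ mmulOp (R ∘ e) + mmulOp (fgradMat n e R) := by
  have h2 : mmulOp R ∘ₗ fgradAdj n (liftEquiv e ι) = -(mmulOp R ∘ₗ bgrad n (liftEquiv e ι)) := by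
    rw [bgrad_eq_neg_fgradAdj, LinearMap.comp_neg, neg_neg]
  rw [h2, mmulOp_comp_bgrad_eq, bgrad_eq_neg_fgradAdj, LinearMap.neg_comp, neg_sub, sub_neg_eq_add, add_comm]

omit [DecidableEq ι] in
/-- ★ `𝒢∘(M_R∇⁺*_e + M_B) = (𝒢∘∇⁺*_e)∘M_{R∘e} + 𝒢∘M_{∇R} + 𝒢∘M_B` — the edition for the U ≡ 1 knit's letter `E := fgradAdj` (g13 `…NeumannKnitEntryTwo`). [cite: Balaban1985BackgroundPropagators, (3.42) p.397 (entry 2: shape), (3.64)–(3.65) pp.402–403] -/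
theorem comp_covShape_fgradAdj_eq (n : ℝ) (e : X ≃ X) (R B : X → Matrix ι ι ℝ) (G : (X × ι → ℝ) →ₗ[ℝ] (X × ι → ℝ)) :
    G ∘ₗ (mmulOp R ∘ₗ fgradAdj n (liftEquiv e ι) + mmulOp B) = (G ∘ₗ fgradAdj n (liftEquiv e ι)) ∘ₗ mmulOp (R ∘ e) + G ∘ₗ mmulOp (fgradMat n e R) + G ∘ₗ mmulOp B := by
  rw [LinearMap.comp_add, mmulOp_comp_fgradAdj_eq, LinearMap.comp_add, LinearMap.comp_assoc]

end Algebra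

/-! ## §2 The row, plain currency -/

section Rows

variable {X X' ι : Type} [Fintype X] [Fintype X'] [Fintype ι] [DecidableEq ι] {g : B6.Geometry} (blk : X → g.Site) (π : X' → X)

omit [Fintype X'] [DecidableEq ι] in
/-- `T ≤ ce^{−δd}` (`c ≥ 0`), `Σ_k|B(x)_{ik}| ≤ r_B` ⟹ `T∘M_B ≤ c·r_B·e^{−δd}`. [folklore] -/
theorem hasMaj_comp_mmulOp_plain {T : (X × ι → ℝ) →ₗ[ℝ] (X × ι → ℝ)} {B : X → Matrix ι ι ℝ} {c rB δ : ℝ} (hc : 0 ≤ c) (hrB : 0 ≤ rB) (hB : ∀ x i, ∑ k, |B x i k| ≤ rB)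
    (hT : HasMaj (BlockNorm.ofBlocks g (liftBlk blk ι)) (BlockNorm.ofBlocks g (liftBlk blk ι)) T (fun y y' => c * Real.exp (-(δ * g.dist y y')))) :
    HasMaj (BlockNorm.ofBlocks g (liftBlk blk ι)) (BlockNorm.ofBlocks g (liftBlk blk ι)) (T ∘ₗ mmulOp B) (fun y y' => c * rB * Real.exp (-(δ * g.dist y y'))) := by
  refine (hasMaj_comp_diag (liftBlk blk ι) (fun y y' => mul_nonneg hc (Real.exp_nonneg _)) hT (hasMaj_mmulOp (g := g) blk (C := B) (m := fun _ => rB) (fun _ => hrB) hB)).mono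
    fun y y' => le_of_eq ?_
  ring

omit [Fintype X'] [DecidableEq ι] in
/-- ★ **THE ROW OF THE GLUED COVARIANT ENTRY**: `𝒢_D ≤ c_De^{−δd}`, `𝒢 ≤ ce^{−δd}`, coefficient row sums `r_R, r_{∇R}, r_B` ⟹ `𝒢_D∘M_R − 𝒢∘M_{R′} + 𝒢∘M_B ≤ (c_Dr_R + c·r_{∇R} + c·r_B)e^{−δd}`.
[cite: Balaban1985BackgroundPropagators, (3.42) p.397 (entry 2: shape); Balaban1984PropagatorsII, (2.133) p.247] -/
theorem hasMaj_gluedCovShape {G GD : (X × ι → ℝ) →ₗ[ℝ] (X × ι → ℝ)} {R R' B : X → Matrix ι ι ℝ} {c cD rR rR' rB δ : ℝ} (hc : 0 ≤ c) (hcD : 0 ≤ cD) (hrR : 0 ≤ rR) (hrR' : 0 ≤ rR')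
    (hrB : 0 ≤ rB) (hR : ∀ x i, ∑ k, |R x i k| ≤ rR) (hR' : ∀ x i, ∑ k, |R' x i k| ≤ rR') (hB : ∀ x i, ∑ k, |B x i k| ≤ rB)
    (hGD : HasMaj (BlockNorm.ofBlocks g (liftBlk blk ι)) (BlockNorm.ofBlocks g (liftBlk blk ι)) GD (fun y y' => cD * Real.exp (-(δ * g.dist y y'))))
    (hG : HasMaj (BlockNorm.ofBlocks g (liftBlk blk ι)) (BlockNorm.ofBlocks g (liftBlk blk ι)) G (fun y y' => c * Real.exp (-(δ * g.dist y y')))) :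
    HasMaj (BlockNorm.ofBlocks g (liftBlk blk ι)) (BlockNorm.ofBlocks g (liftBlk blk ι)) (GD ∘ₗ mmulOp R - G ∘ₗ mmulOp R' + G ∘ₗ mmulOp B)
      (fun y y' => (cD * rR + c * rR' + c * rB) * Real.exp (-(δ * g.dist y y'))) := by
  refine (((hasMaj_comp_mmulOp_plain blk hcD hrR hR hGD).sub (hasMaj_comp_mmulOp_plain blk hc hrR' hR' hG)).add (hasMaj_comp_mmulOp_plain blk hc hrB hB hG)).mono fun y y' => le_of_eq ?_
  ring

/-! ## §3 The two-grid η-defect, plain currency -/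

omit [DecidableEq ι] in
/-- `𝔇(T′∘M_{B_f}, T∘M_B) ≤ (c·o_B + m·r_B)e^{−δd}` from the fine row `T′ ≤ ce^{−δd}`, the defect `𝔇(T′,T) ≤ me^{−δd}`, the coarse row sums `r_B` and the row fit `o_B` across `π` (`idef_comp`).
[cite: Balaban1985BackgroundPropagators, Thm 3.14 pp.426–427 (difference template)] -/
theorem hasMaj_idef_comp_mmulOp_plain {T : (X × ι → ℝ) →ₗ[ℝ] (X × ι → ℝ)} {T' : (X' × ι → ℝ) →ₗ[ℝ] (X' × ι → ℝ)} {B : X → Matrix ι ι ℝ} {Bf : X' → Matrix ι ι ℝ} {c m rB oB δ : ℝ}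
    (hc : 0 ≤ c) (hm : 0 ≤ m) (hrB : 0 ≤ rB) (hoB : 0 ≤ oB) (hB : ∀ x i, ∑ k, |B x i k| ≤ rB) (hfB : ∀ x' i, ∑ k, |Bf x' i k - B (π x') i k| ≤ oB)
    (hT' : HasMaj (BlockNorm.ofBlocks g (liftBlk (blk ∘ π) ι)) (BlockNorm.ofBlocks g (liftBlk (blk ∘ π) ι)) T' (fun y y' => c * Real.exp (-(δ * g.dist y y'))))
    (hD : HasMaj (BlockNorm.ofBlocks g (liftBlk blk ι)) (BlockNorm.ofBlocks g (liftBlk (blk ∘ π) ι)) (idef (pull (liftMap π ι)) (pull (liftMap π ι)) T' T) (fun y y' => m * Real.exp (-(δ * g.dist y y')))) :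
    HasMaj (BlockNorm.ofBlocks g (liftBlk blk ι)) (BlockNorm.ofBlocks g (liftBlk (blk ∘ π) ι)) (idef (pull (liftMap π ι)) (pull (liftMap π ι)) (T' ∘ₗ mmulOp Bf) (T ∘ₗ mmulOp B))
      (fun y y' => (c * oB + m * rB) * Real.exp (-(δ * g.dist y y'))) := by
  rw [idef_comp (pull (liftMap π ι)) (pull (liftMap π ι)) (pull (liftMap π ι)) T' (mmulOp Bf) T (mmulOp B)]
  have t1 := hasMaj_comp_diag (liftBlk (blk ∘ π) ι) (fun y y' => mul_nonneg hc (Real.exp_nonneg _)) hT' (hasMaj_idef_mmulOp (g := g) blk π (C' := Bf) (C := B) (o := fun _ => oB) (fun _ => hoB) hfB)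
  have t2 := hasMaj_comp_diag (liftBlk blk ι) (fun y y' => mul_nonneg hm (Real.exp_nonneg _)) hD (hasMaj_mmulOp (g := g) blk (C := B) (m := fun _ => rB) (fun _ => hrB) hB)
  refine (t1.add t2).mono fun y y' => le_of_eq ?_
  ring

omit [DecidableEq ι] in
/-- ★★ **THE TWO-GRID η-DEFECT OF THE GLUED COVARIANT ENTRY**: fine rows `𝒢′_D ≤ c_D`, `𝒢′ ≤ c`, defects `𝔇(𝒢′_D, 𝒢_D) ≤ m_D`, `𝔇(𝒢′, 𝒢) ≤ m` (rate `δ`; FILE 158 ★★★ ∕ FILE 44 supply them), coarse coefficient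
row sums `r_R, r_{∇R}, r_B`, row fits `o_R, o_{∇R}, o_B` ⟹ `𝔇(𝒢′_D∘M_{R_f} − 𝒢′∘M_{R′_f} + 𝒢′∘M_{B_f}, 𝒢_D∘M_R − 𝒢∘M_{R′} + 𝒢∘M_B) ≤ [(c_Do_R + m_Dr_R) + (c·o_{∇R} + m·r_{∇R}) + (c·o_B + m·r_B)]e^{−δd}`.
[cite: Balaban1985BackgroundPropagators, Thm 3.14 pp.426–427 (difference template), (3.42) p.397 (entry 2: shape)] -/
theorem hasMaj_idef_gluedCovShape {G GD : (X × ι → ℝ) →ₗ[ℝ] (X × ι → ℝ)} {G' GD' : (X' × ι → ℝ) →ₗ[ℝ] (X' × ι → ℝ)} {R R' B : X → Matrix ι ι ℝ} {Rf Rf' Bf : X' → Matrix ι ι ℝ}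
    {c cD m mD rR rR' rB oR oR' oB δ : ℝ} (hc : 0 ≤ c) (hcD : 0 ≤ cD) (hm : 0 ≤ m) (hmD : 0 ≤ mD) (hrR : 0 ≤ rR) (hrR' : 0 ≤ rR') (hrB : 0 ≤ rB) (hoR : 0 ≤ oR) (hoR' : 0 ≤ oR') (hoB : 0 ≤ oB)
    (hR : ∀ x i, ∑ k, |R x i k| ≤ rR) (hR' : ∀ x i, ∑ k, |R' x i k| ≤ rR') (hB : ∀ x i, ∑ k, |B x i k| ≤ rB)
    (hfR : ∀ x' i, ∑ k, |Rf x' i k - R (π x') i k| ≤ oR) (hfR' : ∀ x' i, ∑ k, |Rf' x' i k - R' (π x') i k| ≤ oR') (hfB : ∀ x' i, ∑ k, |Bf x' i k - B (π x') i k| ≤ oB)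
    (hGD' : HasMaj (BlockNorm.ofBlocks g (liftBlk (blk ∘ π) ι)) (BlockNorm.ofBlocks g (liftBlk (blk ∘ π) ι)) GD' (fun y y' => cD * Real.exp (-(δ * g.dist y y'))))
    (hG' : HasMaj (BlockNorm.ofBlocks g (liftBlk (blk ∘ π) ι)) (BlockNorm.ofBlocks g (liftBlk (blk ∘ π) ι)) G' (fun y y' => c * Real.exp (-(δ * g.dist y y'))))
    (hDGD : HasMaj (BlockNorm.ofBlocks g (liftBlk blk ι)) (BlockNorm.ofBlocks g (liftBlk (blk ∘ π) ι)) (idef (pull (liftMap π ι)) (pull (liftMap π ι)) GD' GD) (fun y y' => mD * Real.exp (-(δ * g.dist y y'))))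
    (hDG : HasMaj (BlockNorm.ofBlocks g (liftBlk blk ι)) (BlockNorm.ofBlocks g (liftBlk (blk ∘ π) ι)) (idef (pull (liftMap π ι)) (pull (liftMap π ι)) G' G) (fun y y' => m * Real.exp (-(δ * g.dist y y')))) :
    HasMaj (BlockNorm.ofBlocks g (liftBlk blk ι)) (BlockNorm.ofBlocks g (liftBlk (blk ∘ π) ι))
      (idef (pull (liftMap π ι)) (pull (liftMap π ι)) (GD' ∘ₗ mmulOp Rf - G' ∘ₗ mmulOp Rf' + G' ∘ₗ mmulOp Bf) (GD ∘ₗ mmulOp R - G ∘ₗ mmulOp R' + G ∘ₗ mmulOp B))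
      (fun y y' => (((cD * oR + mD * rR) + (c * oR' + m * rR')) + (c * oB + m * rB)) * Real.exp (-(δ * g.dist y y'))) := by
  rw [idef_add, idef_sub]
  refine (((hasMaj_idef_comp_mmulOp_plain blk π hcD hmD hrR hoR hR hfR hGD' hDGD).sub (hasMaj_idef_comp_mmulOp_plain blk π hc hm hrR' hoR' hR' hfR' hG' hDG)).add
    (hasMaj_idef_comp_mmulOp_plain blk π hc hm hrB hoB hB hfB hG' hDG)).mono fun y y' => le_of_eq ?_
  ring

end Rows

end Summit.QuantumFields.YangMills.BalabanUVNodes.N15.Gluing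

end
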